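import Literature.Computability.Cryptography.UOWHFChainCompose
import Literature.Computability.Cryptography.InaccessibleEntropyUOWHFInverterBricks
import HarnessLib

/-!
# Merkle–Damgård composition at a fixed level, II: the level-planting reduction as a machine

Topic `Literature/Computability/Cryptography`; continues `UOWHFChainCompose.lean` (Goldreich 2004, Construction
6.4.22 at one level; proof of Prop. 6.4.23). From a two-stage designated-collision adversary `(A₀, A)` against
the composed collection `compose S` (target coins `ρ ∈ {0,1}^{q(n)}`) we build the two-stage adversary `(B₀, B)`
against the basic collection `base S`: its coins `r_B ∈ {0,1}^{M_Q(n)}` (`Q = q + p₂ + P_R`, so that `n` is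
recovered from `|r_B|`) carry a guessed chain level `i ≤ R` (binary, clamped), the coins `ρ` of `A₀`, and the coins
`kb` of all `R+1` composed keys;

* `B₀(r_B)` = the level-`i` chain state `z_i(A₀(ρ))` under the keys `kb` (which only uses the keys below `i`);
* `B(1ⁿ, s, r_B; ω)`: splice the challenge key (the coins of `s`) into block `i` of `kb`, run
  `A(1ⁿ, 1ⁿ0 kb', ρ; ω)` and answer with the level-`i` state of its output under `kb'`.

Everything is given as string functions with FP bricks (`B0P`, `BrunP`) and value lemmas, and packaged as
`B0fun` / `redB : RandAlg` with `isPPT_redB`, `B0P_mem_FP`. The success analysis is the next file.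
All statements proved; no named facts.

## References

* O. Goldreich, *Foundations of Cryptography II*, CUP 2004, §6.4.3.2, proof of Prop. 6.4.23 (the collision-forming
  `A'` derived from `A`, planting at a uniformly selected position).
* M. Naor, M. Yung, *Universal one-way hash functions and their cryptographic applications*, STOC 1989, Lemma 2.1.
-/

namespace Literature.Computability.Cryptography

namespace MDCompose

open _root_.Computability Complexity Complexity.Brick Complexity.Plumb Polynomial
open HHRVW (catF catF_apply catF_mem_FP fitLen splice spliceP spliceP_apply spliceP_mem_FP length_splice)

/-! ### String semantics of the reduction -/

section Strings

variable (S : Spec) (q : Polynomial ℕ) (A₀ : List Bool → List Bool) (A : RandAlg (List Bool) (List Bool))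

/-- Bits of the level guess: `|bin R(n)|`. [folklore] -/
def aRb (n : ℕ) : ℕ := (encodeNat (S.R n)).length

/-- The coin polynomial of `B` is `M_Q` with `Q = q + p₂ + P_R` (so `|r_B| = Q(n) + n + 1 ≥ aRb + q + p₂`). [folklore] -/
noncomputable def Q : Polynomial ℕ := q + S.p₂ + S.PR

/-- The guessed level `i = min(⟦r_B ↾ aRb⟧, R)`. [cite: Goldreich2004, proof of Prop. 6.4.23 ("uniformly selects i")] -/
def iOf (n : ℕ) (rB : List Bool) : ℕ := min (bitsToNat (rB.take (aRb S n))) (S.R n)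

/-- The coins of `A₀` inside `r_B`. [folklore] -/
def ρOf (n : ℕ) (rB : List Bool) : List Bool := (rB.drop (aRb S n)).take (q.eval n)

/-- The coins of the composed keys inside `r_B`. [folklore] -/
def kbOf (n : ℕ) (rB : List Bool) : List Bool := (rB.drop (aRb S n + q.eval n)).take (S.p₂.eval n)

/-- **`B₀` at level `n`**: the level-`i` state of `A₀(ρ)` under the keys `kb`. [cite: Goldreich2004, proof of Prop. 6.4.23] -/
def tgt (n : ℕ) (rB : List Bool) : List Bool := chainSt S n (kbOf S q n rB) (A₀ (ρOf S q n rB)) (iOf S n rB)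

/-- **`B₀`** (the level read off `|r_B| = M_Q(n)`). [cite: Goldreich2004, proof of Prop. 6.4.23] -/
noncomputable def B0fun (rB : List Bool) : List Bool := tgt S q A₀ (LenPres.nOf (Q S q) rB.length) rB

/-- The coins of the challenge index `s = 1ⁿ 0 ks`. [folklore] -/
def ksOf (n : ℕ) (s : List Bool) : List Bool := s.drop (n + 1)

/-- The composed key coins with the challenge spliced into block `i`. [cite: Goldreich2004, proof of Prop. 6.4.23] -/
def kbS (n : ℕ) (s rB : List Bool) : List Bool := splice (S.p.eval n) (iOf S n rB) (ksOf n s) (kbOf S q n rB)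

/-- The composed index handed to `A`. [folklore] -/
def sbar (n : ℕ) (s rB : List Bool) : List Bool := ones n ++ false :: kbS S q n s rB

/-- `A`'s answer. [folklore] -/
def xA (n : ℕ) (s rB ω : List Bool) : List Bool := A.run (boolPair (unaryEncodeNat n) (boolPair (sbar S q n s rB) (ρOf S q n rB))) ω

/-- **`B`'s output**: the level-`i` state of `A`'s answer under the spliced keys. [cite: Goldreich2004, proof of Prop. 6.4.23] -/
def outB (n : ℕ) (s rB ω : List Bool) : List Bool := chainSt S n (kbS S q n s rB) (xA S q A n s rB ω) (iOf S n rB)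

/-- The length of `A`'s input `⟨1ⁿ, ⟨s̄, ρ⟩⟩` (a function of `n`). [folklore] -/
noncomputable def lenA2 (n : ℕ) : ℕ := (boolPair (unaryEncodeNat n) (boolPair (ones (LenPres.M S.p₂ n)) (ones (q.eval n)))).length

/-- The length of `B`'s input `⟨1ⁿ, ⟨s, r_B⟩⟩` (a function of `n`). [folklore] -/
noncomputable def lenIn (n : ℕ) : ℕ := (boolPair (unaryEncodeNat n) (boolPair (ones (LenPres.M S.p n)) (ones (LenPres.M (Q S q) n)))).length

/-- `n` from `B`'s input length (used only by the coin-length function). [folklore] -/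
noncomputable def nOfIn (L : ℕ) : ℕ := Nat.findGreatest (fun m => lenIn S q m ≤ L) L

variable {S q A₀ A}

/-- `lenIn` is strictly increasing. [folklore] -/
theorem lenIn_strictMono : StrictMono (lenIn S q) := by
  refine strictMono_nat_of_lt_succ fun n => ?_
  have h1 := LenPres.M_strictMono (p := S.p) (Nat.lt_add_one n)
  have h2 := LenPres.M_strictMono (p := Q S q) (Nat.lt_add_one n)
  simp only [lenIn, length_boolPair, unaryEncodeNat_eq_replicate, List.length_replicate, ones]
  omega

/-- `nOfIn (lenIn n) = n`. [folklore] -/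
theorem nOfIn_lenIn (n : ℕ) : nOfIn S q (lenIn S q n) = n := by
  rw [nOfIn, Nat.findGreatest_eq_iff]
  refine ⟨lenIn_strictMono.id_le n, fun _ => le_rfl, fun m hm _ h => ?_⟩
  exact absurd h (not_le.2 (lenIn_strictMono hm))

/-- `|r_B| = M_Q(n)` determines the level. [folklore] -/
theorem nOf_Q (n : ℕ) : LenPres.nOf (Q S q) (LenPres.M (Q S q) n) = n :=
  LenPres.nOf_eq le_rfl (LenPres.M_strictMono (Nat.lt_succ_self n))

/-- The coin fields fit: `aRb + q + p₂ ≤ M_Q(n)`. [folklore] -/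
theorem fields_le (hS : S.WF) (n : ℕ) : aRb S n + q.eval n + S.p₂.eval n ≤ LenPres.M (Q S q) n := by
  have h1 : aRb S n ≤ S.R n := UExpr.blen_le (fun _ => S.R n) (UExpr.var 0)
  have h2 := hS.R_le n
  simp only [LenPres.M, Q, eval_add]
  omega

/-- The guessed level is at most `R`. [folklore] -/
theorem iOf_le (n : ℕ) (rB : List Bool) : iOf S n rB ≤ S.R n := min_le_right _ _

/-- `|ρ| = q n` for long enough coins. [folklore] -/
theorem length_ρOf (hS : S.WF) {n : ℕ} {rB : List Bool} (h : rB.length = LenPres.M (Q S q) n) : (ρOf S q n rB).length = q.eval n := by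
  have := fields_le (q := q) hS n
  rw [ρOf, List.length_take, List.length_drop, h, min_eq_left]; omega

/-- `|kb| = p₂ n` for long enough coins. [folklore] -/
theorem length_kbOf (hS : S.WF) {n : ℕ} {rB : List Bool} (h : rB.length = LenPres.M (Q S q) n) : (kbOf S q n rB).length = S.p₂.eval n := by
  have := fields_le (q := q) hS n
  rw [kbOf, List.length_take, List.length_drop, h, min_eq_left]; omega

/-- `|kbS| = p₂ n` for a well-formed challenge. [folklore] -/
theorem length_kbS (hS : S.WF) {n : ℕ} {s rB : List Bool} (hs : (ksOf n s).length = S.p.eval n) (h : rB.length = LenPres.M (Q S q) n) :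
    (kbS S q n s rB).length = S.p₂.eval n := by
  rw [kbS, length_splice hs, length_kbOf hS h]
  rw [length_kbOf hS h]
  exact le_trans (Nat.mul_le_mul_right _ (Nat.succ_le_succ (iOf_le n rB))) (hS.p₂_ge n)

end Strings

/-! ### The bricks -/

section Bricks

variable (S : Spec) (q : Polynomial ℕ) (A₀ : List Bool → List Bool) (A : RandAlg (List Bool) (List Bool))

/-- On the pair record `P = ⟨1ⁿ, r_B⟩`: `1^{aRb n}`. [folklore] -/
noncomputable def aRbU : List Bool → List Bool := onesFn ∘ lenBinF ∘ S.RF ∘ fstF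

/-- On `P`: the guessed level `1^i`. [cite: Goldreich2004, proof of Prop. 6.4.23] -/
noncomputable def iU : List Bool → List Bool := binToUnaryFn ∘ fanoutFn (S.RF ∘ fstF) (takeFn ∘ fanoutFn (aRbU S) sndF)

/-- On `P`: the coins `ρ`. [folklore] -/
noncomputable def ρF : List Bool → List Bool := takeFn ∘ fanoutFn (polyFn q ∘ fstF) (dropFn ∘ fanoutFn (aRbU S) sndF)

/-- On `P`: the key coins `kb`. [folklore] -/
noncomputable def kbF : List Bool → List Bool :=
  takeFn ∘ fanoutFn (polyFn S.p₂ ∘ fstF) (dropFn ∘ fanoutFn (catF (aRbU S) (polyFn q ∘ fstF)) sndF)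

variable (n : ℕ) (rB : List Bool)

/-- The pair record. [folklore] -/
def Prec : List Bool := boolPair (ones n) rB

variable {n rB}

/-- Accessor value. [folklore] -/
@[simp] theorem Prec_fst : fstF (Prec n rB) = ones n := by rw [Prec, fstF_boolPair]
/-- Accessor value. [folklore] -/
@[simp] theorem Prec_snd : sndF (Prec n rB) = rB := by rw [Prec, sndF_boolPair]

/-- Value of `aRbU`. [folklore] -/
theorem aRbU_P (hS : S.WF) : aRbU S (Prec n rB) = ones (aRb S n) := by
  have honesFn : ∀ w : List Bool, onesFn w = ones w.length := fun w => by simp [onesFn, Complexity.unaryEncodeNat_eq_replicate, ones]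
  simp only [aRbU, Function.comp_apply, Prec_fst, hS.RF_apply, lenBinF_apply, honesFn, aRb]; simp [ones]

/-- Value of `iU`. [folklore] -/
theorem iU_P (hS : S.WF) : iU S (Prec n rB) = ones (iOf S n rB) := by
  simp only [iU, Function.comp_apply, fanoutFn_apply, aRbU_P S hS, Prec_fst, Prec_snd, hS.RF_apply, takeFn_boolPair,
    binToUnaryFn_boolPair, iOf]
  simp [ones]

/-- Value of `ρF`. [folklore] -/
theorem ρF_P (hS : S.WF) : ρF S q (Prec n rB) = ρOf S q n rB := by
  simp only [ρF, Function.comp_apply, fanoutFn_apply, aRbU_P S hS, Prec_fst, Prec_snd, polyFn_apply, dropFn_boolPair, takeFn_boolPair, ρOf]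
  simp [ones]

/-- Value of `kbF`. [folklore] -/
theorem kbF_P (hS : S.WF) : kbF S q (Prec n rB) = kbOf S q n rB := by
  simp only [kbF, Function.comp_apply, fanoutFn_apply, catF_apply, aRbU_P S hS, Prec_fst, Prec_snd, polyFn_apply, dropFn_boolPair,
    takeFn_boolPair, kbOf]
  simp [ones]

/-- `aRbU ∈ FP`. [folklore] -/
theorem aRbU_mem_FP (hS : S.WF) : aRbU S ∈ FP :=
  comp_mem_FP onesFn_mem_FP (comp_mem_FP lenBinF_mem_FP (comp_mem_FP hS.RF_mem fstF_mem_FP))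
/-- `iU ∈ FP`. [folklore] -/
theorem iU_mem_FP (hS : S.WF) : iU S ∈ FP :=
  comp_mem_FP binToUnaryFn_mem_FP (fanoutFn_mem_FP (comp_mem_FP hS.RF_mem fstF_mem_FP)
    (comp_mem_FP takeFn_mem_FP (fanoutFn_mem_FP (aRbU_mem_FP S hS) sndF_mem_FP)))
/-- `ρF ∈ FP`. [folklore] -/
theorem ρF_mem_FP (hS : S.WF) : ρF S q ∈ FP :=
  comp_mem_FP takeFn_mem_FP (fanoutFn_mem_FP (comp_mem_FP (polyFn_mem_FP _) fstF_mem_FP)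
    (comp_mem_FP dropFn_mem_FP (fanoutFn_mem_FP (aRbU_mem_FP S hS) sndF_mem_FP)))
/-- `kbF ∈ FP`. [folklore] -/
theorem kbF_mem_FP (hS : S.WF) : kbF S q ∈ FP :=
  comp_mem_FP takeFn_mem_FP (fanoutFn_mem_FP (comp_mem_FP (polyFn_mem_FP _) fstF_mem_FP)
    (comp_mem_FP dropFn_mem_FP (fanoutFn_mem_FP (catF_mem_FP (aRbU_mem_FP S hS) (comp_mem_FP (polyFn_mem_FP _) fstF_mem_FP)) sndF_mem_FP)))

/-- The partial-chain initialisation on `⟨X, 1^i⟩`: `⟨X, ⟨bin i, ⟨1⁰, x ↾ d⟩⟩⟩`. [folklore] -/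
noncomputable def initUptoF : List Bool → List Bool :=
  fanoutFn fstF (fanoutFn (lenBinF ∘ sndF) (fanoutFn (fun _ => []) (takeFn ∘ fanoutFn (CdF S ∘ fstF) (CxF ∘ fstF))))

/-- **The partial chain** `⟨X, 1^i⟩ ↦ z_i`. [cite: Goldreich2004, proof of Prop. 6.4.23] -/
noncomputable def uptoP : List Bool → List Bool := sndPow 2 ∘ loopF S ∘ initUptoF S

/-- Value of the initialisation. [folklore] -/
theorem initUptoF_apply (hS : S.WF) (n : ℕ) (kb x : List Bool) (i : ℕ) :
    initUptoF S (boolPair (Xrec n kb x) (ones i)) = Zrec n kb x (encodeNat i) 0 (x.take (S.dL n)) := by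
  rw [initUptoF, fanoutFn_apply, fanoutFn_apply, fanoutFn_apply, fstF_boolPair, Function.comp_apply, sndF_boolPair, lenBinF_apply,
    Function.comp_apply, fanoutFn_apply, Function.comp_apply, Function.comp_apply, fstF_boolPair, XdF_X S hS, XxF_X, takeFn_boolPair]
  simp [Zrec, ones]

/-- **`uptoP ⟨X, 1^i⟩ = z_i`** for `i ≤ R` on well-formed records. [cite: Goldreich2004, proof of Prop. 6.4.23] -/
theorem uptoP_apply (hS : S.WF) {n : ℕ} {kb x : List Bool} (hkb : (S.R n + 1) * S.p.eval n ≤ kb.length) (hx : x.length = S.dL n + S.R n)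
    {i : ℕ} (hi : i ≤ S.R n) : uptoP S (boolPair (Xrec n kb x) (ones i)) = chainSt S n kb x i := by
  have hR : i ≤ S.PR.eval (Xrec n kb x).length :=
    hi.trans ((hS.R_le n).trans (TM2Iter.eval_mono S.PR (by simp [Xrec, ones]; omega)))
  rw [uptoP, Function.comp_apply, Function.comp_apply, initUptoF_apply S hS, loopF, Zrec, fstF_boolPair, iterate_loopStep _ _ _ _ _ hR,
    show x.take (S.dL n) = chainSt S n kb x 0 from rfl, loopModel_bodyF S hS hkb hx i 0 (by omega), Nat.zero_add]
  simp

/-- `uptoP ∈ FP`. [folklore] -/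
theorem uptoP_mem_FP (hS : S.WF) : uptoP S ∈ FP :=
  comp_mem_FP (sndPow_mem_FP 2) (comp_mem_FP (loopF_mem_FP S hS)
    (fanoutFn_mem_FP fstF_mem_FP (fanoutFn_mem_FP (comp_mem_FP lenBinF_mem_FP sndF_mem_FP) (fanoutFn_mem_FP (const_mem_FP _)
      (comp_mem_FP takeFn_mem_FP (fanoutFn_mem_FP (comp_mem_FP (XdF_mem_FP S hS) fstF_mem_FP) (comp_mem_FP XxF_mem_FP fstF_mem_FP)))))))

/-- **The brick of `B₀`** on `r_B`: pair record `⟨1^{nOf Q |r_B|}, r_B⟩`, then `uptoP ⟨⟨1ⁿ, ⟨kb, A₀ ρ⟩⟩, 1^i⟩`.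
[cite: Goldreich2004, proof of Prop. 6.4.23] -/
noncomputable def B0P : List Bool → List Bool :=
  uptoP S ∘ fanoutFn (fanoutFn fstF (fanoutFn (kbF S q) (A₀ ∘ ρF S q))) (iU S) ∘ fanoutFn (LenPres.nOfFn (Q S q)) id

/-- The pair record of `B₀`. [folklore] -/
theorem B0_prec (rB : List Bool) : fanoutFn (LenPres.nOfFn (Q S q)) id rB = Prec (LenPres.nOf (Q S q) rB.length) rB := by
  rw [fanoutFn_apply, LenPres.nOfFn_apply, id, Prec]

/-- **Value of `B0P`**: `B0P r_B = B0fun r_B` whenever `A₀`'s target has the domain length (else junk of no import).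
[cite: Goldreich2004, proof of Prop. 6.4.23] -/
theorem B0P_apply (hS : S.WF) {n : ℕ} {rB : List Bool} (hrB : rB.length = LenPres.M (Q S q) n)
    (hx : (A₀ (ρOf S q n rB)).length = S.dL n + S.R n) : B0P S q A₀ rB = B0fun S q A₀ rB := by
  have hn : LenPres.nOf (Q S q) rB.length = n := by rw [hrB]; exact nOf_Q n
  rw [B0P, Function.comp_apply, Function.comp_apply, B0_prec, hn, fanoutFn_apply, fanoutFn_apply, fanoutFn_apply, Function.comp_apply,
    iU_P S hS, kbF_P S q hS, ρF_P S q hS, Prec_fst,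
    show boolPair (ones n) (boolPair (kbOf S q n rB) (A₀ (ρOf S q n rB))) = Xrec n (kbOf S q n rB) (A₀ (ρOf S q n rB)) from rfl,
    uptoP_apply S hS (by rw [length_kbOf hS hrB]; exact hS.p₂_ge n) hx (iOf_le n rB), B0fun, hn, tgt]

/-- `B0P ∈ FP` for `A₀ ∈ FP`. [cite: Goldreich2004, proof of Prop. 6.4.23 ("polynomial-time")] -/
theorem B0P_mem_FP (hS : S.WF) (hA₀ : A₀ ∈ FP) : B0P S q A₀ ∈ FP :=
  comp_mem_FP (uptoP_mem_FP S hS) (comp_mem_FP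
    (fanoutFn_mem_FP (fanoutFn_mem_FP fstF_mem_FP (fanoutFn_mem_FP (kbF_mem_FP S q hS) (comp_mem_FP hA₀ (ρF_mem_FP S q hS)))) (iU_mem_FP S hS))
    (fanoutFn_mem_FP (LenPres.nOfFn_mem_FP _) (PolyTimeComputable.id _)))

/-- `A` as a string function `⟨inp, ω⟩ ↦ A(inp; ω)`. [folklore] -/
def bFn : List Bool → List Bool := Function.uncurry A.run ∘ boolUnpair

/-- `bFn A ∈ FP` for PPT `A`. [folklore] -/
theorem bFn_mem_FP (hA : IsPPT A id) : bFn A ∈ FP := by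
  show PolyTimeComputable id id (Function.uncurry A.run ∘ boolUnpair)
  exact PolyTimeComputable.comp_holds hA.1 polyTimeComputable_boolUnpair

/-- On `B`'s record `Z = ⟨⟨1ⁿ, ⟨s, r_B⟩⟩, ω⟩`: the pair record `⟨1ⁿ, r_B⟩`. [folklore] -/
noncomputable def ZPF : List Bool → List Bool := fanoutFn (fstF ∘ fstF) (sndPow 1 ∘ fstF)
/-- On `Z`: the challenge index `s`. [folklore] -/
noncomputable def ZsF : List Bool → List Bool := nthF 1 ∘ fstF
/-- On `Z`: the coins `ks` of the challenge index, `s ⇂ (n+1)`. [folklore] -/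
noncomputable def ZksF : List Bool → List Bool := dropFn ∘ fanoutFn (catF (fstF ∘ fstF) fun _ => [true]) (ZsF)
/-- On `Z`: the spliced key coins `kb'`. [cite: Goldreich2004, proof of Prop. 6.4.23] -/
noncomputable def ZkbF : List Bool → List Bool :=
  spliceP ∘ fanoutFn (polyFn S.p ∘ fstF ∘ fstF) (fanoutFn (iU S ∘ ZPF) (fanoutFn ZksF (kbF S q ∘ ZPF)))
/-- On `Z`: the composed index `1ⁿ 0 kb'`. [folklore] -/
noncomputable def ZsbarF : List Bool → List Bool := catF (fstF ∘ fstF) (List.cons false ∘ ZkbF S q)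
/-- On `Z`: `A`'s answer. [folklore] -/
noncomputable def ZxF : List Bool → List Bool := bFn A ∘ fanoutFn (fanoutFn (fstF ∘ fstF) (fanoutFn (ZsbarF S q) (ρF S q ∘ ZPF))) sndF

/-- **The brick of `B`** on `Z`: `uptoP ⟨⟨1ⁿ, ⟨kb', x_A⟩⟩, 1^i⟩`. [cite: Goldreich2004, proof of Prop. 6.4.23] -/
noncomputable def BrunP : List Bool → List Bool :=
  uptoP S ∘ fanoutFn (fanoutFn (fstF ∘ fstF) (fanoutFn (ZkbF S q) (ZxF S q A))) (iU S ∘ ZPF)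

/-- `B`'s record. [folklore] -/
def Zin (n : ℕ) (rB s ω : List Bool) : List Bool := boolPair (boolPair (unaryEncodeNat n) (boolPair s rB)) ω

variable {s ω : List Bool}

/-- Accessor values on `Z`. [folklore] -/
theorem ZPF_Z : ZPF (Zin n rB s ω) = Prec n rB := by
  simp [ZPF, Zin, Prec, unaryEncodeNat_eq_replicate]
/-- Accessor values on `Z`. [folklore] -/
theorem Zn_Z : (fstF ∘ fstF) (Zin n rB s ω) = ones n := by simp [Zin, unaryEncodeNat_eq_replicate, ones]
/-- Accessor values on `Z`. [folklore] -/
theorem ZksF_Z : ZksF (Zin n rB s ω) = ksOf n s := by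
  rw [ZksF, Function.comp_apply, fanoutFn_apply, catF_apply, Zn_Z, ZsF]
  simp [Zin, nthF, ones, ksOf]
/-- Accessor values on `Z`. [folklore] -/
theorem ZkbF_Z (hS : S.WF) : ZkbF S q (Zin n rB s ω) = kbS S q n s rB := by
  rw [ZkbF, Function.comp_apply, fanoutFn_apply, fanoutFn_apply, fanoutFn_apply, Function.comp_apply, Zn_Z, polyFn_apply,
    Function.comp_apply, ZPF_Z, iU_P S hS, ZksF_Z, Function.comp_apply, ZPF_Z, kbF_P S q hS]
  simp only [ones, List.length_replicate]
  rw [← ones, ← ones, spliceP_apply, kbS]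
/-- Accessor values on `Z`. [folklore] -/
theorem ZsbarF_Z (hS : S.WF) : ZsbarF S q (Zin n rB s ω) = sbar S q n s rB := by
  rw [ZsbarF, catF_apply, Zn_Z, Function.comp_apply, ZkbF_Z S q hS, sbar]
/-- Accessor values on `Z`. [folklore] -/
theorem ZxF_Z (hS : S.WF) : ZxF S q A (Zin n rB s ω) = xA S q A n s rB ω := by
  rw [ZxF, Function.comp_apply, fanoutFn_apply, fanoutFn_apply, fanoutFn_apply, Zn_Z, ZsbarF_Z S q hS, Function.comp_apply, ZPF_Z,
    ρF_P S q hS, bFn, Function.comp_apply]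
  simp [Zin, xA, unaryEncodeNat_eq_replicate, ones]

/-- **Value of `BrunP`** on well-formed records: `|r_B| = M_Q(n)`, `|ks| = p n`, and `A`'s answer of domain length.
[cite: Goldreich2004, proof of Prop. 6.4.23] -/
theorem BrunP_apply (hS : S.WF) {n : ℕ} {rB s ω : List Bool} (hrB : rB.length = LenPres.M (Q S q) n)
    (hs : (ksOf n s).length = S.p.eval n) (hx : (xA S q A n s rB ω).length = S.dL n + S.R n) :
    BrunP S q A (Zin n rB s ω) = outB S q A n s rB ω := by
  rw [BrunP, Function.comp_apply, fanoutFn_apply, fanoutFn_apply, fanoutFn_apply, Zn_Z, ZkbF_Z S q hS, ZxF_Z S q A hS,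
    Function.comp_apply, ZPF_Z, iU_P S hS,
    show boolPair (ones n) (boolPair (kbS S q n s rB) (xA S q A n s rB ω)) = Xrec n (kbS S q n s rB) (xA S q A n s rB ω) from rfl,
    uptoP_apply S hS (by rw [length_kbS hS hs hrB]; exact hS.p₂_ge n) hx (iOf_le n rB), outB]

/-- `BrunP ∈ FP` for PPT `A`. [cite: Goldreich2004, proof of Prop. 6.4.23 ("polynomial-time")] -/
theorem BrunP_mem_FP (hS : S.WF) (hA : IsPPT A id) : BrunP S q A ∈ FP := by
  have hP : ZPF ∈ FP := fanoutFn_mem_FP (comp_mem_FP fstF_mem_FP fstF_mem_FP) (comp_mem_FP (sndPow_mem_FP 1) fstF_mem_FP)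
  have hn : fstF ∘ fstF ∈ FP := comp_mem_FP fstF_mem_FP fstF_mem_FP
  have hks : ZksF ∈ FP := comp_mem_FP dropFn_mem_FP (fanoutFn_mem_FP (catF_mem_FP hn (const_mem_FP _)) (comp_mem_FP (nthF_mem_FP 1) fstF_mem_FP))
  have hkb : ZkbF S q ∈ FP := comp_mem_FP spliceP_mem_FP (fanoutFn_mem_FP (comp_mem_FP (polyFn_mem_FP _) hn)
    (fanoutFn_mem_FP (comp_mem_FP (iU_mem_FP S hS) hP) (fanoutFn_mem_FP hks (comp_mem_FP (kbF_mem_FP S q hS) hP))))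
  have hsb : ZsbarF S q ∈ FP := catF_mem_FP hn (comp_mem_FP (cons_mem_FP false) hkb)
  have hxA : ZxF S q A ∈ FP := comp_mem_FP (bFn_mem_FP A hA) (fanoutFn_mem_FP (fanoutFn_mem_FP hn (fanoutFn_mem_FP hsb
    (comp_mem_FP (ρF_mem_FP S q hS) hP))) sndF_mem_FP)
  exact comp_mem_FP (uptoP_mem_FP S hS) (fanoutFn_mem_FP (fanoutFn_mem_FP hn (fanoutFn_mem_FP hkb hxA)) (comp_mem_FP (iU_mem_FP S hS) hP))

end Bricks

/-! ### The reduction as a randomized algorithm -/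

section Machine

variable (S : Spec) (q : Polynomial ℕ) (A₀ : List Bool → List Bool) (A : RandAlg (List Bool) (List Bool))

/-- **The second stage `B`** of the reduction: run function `BrunP`, coins = those of `A` on the composed query
(carried by the coin count, a function of the input length). [cite: Goldreich2004, proof of Prop. 6.4.23] -/
noncomputable def redB : RandAlg (List Bool) (List Bool) where
  run inp ω := BrunP S q A (boolPair inp ω)
  coinLen L := A.coinLen (lenA2 S q (nOfIn S q L))

variable {S q A₀ A}

/-- `B`'s run on the experiment's input equals `outB` (well-formed case). [cite: Goldreich2004, proof of Prop. 6.4.23] -/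
theorem redB_run (hS : S.WF) {n : ℕ} {rB s ω : List Bool} (hrB : rB.length = LenPres.M (Q S q) n)
    (hs : (ksOf n s).length = S.p.eval n) (hx : (xA S q A n s rB ω).length = S.dL n + S.R n) :
    (redB S q A).run (boolPair (unaryEncodeNat n) (boolPair s rB)) ω = outB S q A n s rB ω :=
  BrunP_apply S q A hS hrB hs hx

/-- The coin count of `B` on the experiment's input is `A`'s coin count on the composed query. [folklore] -/
theorem redB_coinLen (n : ℕ) {s rB : List Bool} (hs : s.length = LenPres.M S.p n) (hrB : rB.length = LenPres.M (Q S q) n) :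
    (redB S q A).coinLen (boolPair (unaryEncodeNat n) (boolPair s rB)).length = A.coinLen (lenA2 S q n) := by
  show A.coinLen (lenA2 S q (nOfIn S q _)) = _
  have : (boolPair (unaryEncodeNat n) (boolPair s rB)).length = lenIn S q n := by
    simp only [lenIn, length_boolPair, hs, hrB, ones, List.length_replicate]
  rw [this, nOfIn_lenIn]

/-- **`B` is PPT** for PPT `A`. [cite: Goldreich2004, proof of Prop. 6.4.23] -/
theorem isPPT_redB (hS : S.WF) (hA : IsPPT A id) : IsPPT (redB S q A) id := by
  refine ⟨?_, ?_⟩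
  · obtain ⟨pc, Mc, hM⟩ := BrunP_mem_FP S q A hS hA
    exact ⟨pc, Mc, fun z => hM (boolPair z.1 z.2)⟩
  · obtain ⟨qA, hqA⟩ := hA.2
    -- `lenA2 n = 2n + 4 + 2 M_{p₂}(n) + q n`, and `nOfIn L ≤ L`
    refine ⟨qA.comp (C 2 * Polynomial.X + C 4 + C 2 * (S.p₂ + Polynomial.X + 1) + q), fun L => ?_⟩
    have hn : nOfIn S q L ≤ L := Nat.findGreatest_le _
    have hlen : lenA2 S q (nOfIn S q L) = 2 * nOfIn S q L + 4 + 2 * LenPres.M S.p₂ (nOfIn S q L) + q.eval (nOfIn S q L) := by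
      simp only [lenA2, length_boolPair, unaryEncodeNat_eq_replicate, List.length_replicate, ones]; ring
    show A.coinLen (lenA2 S q (nOfIn S q L)) ≤ _
    refine (hqA _).trans (TM2Iter.eval_mono qA ?_) |>.trans (le_of_eq (by rw [Polynomial.eval_comp]))
    rw [hlen, LenPres.M]
    simp only [Polynomial.eval_add, Polynomial.eval_mul, Polynomial.eval_C, Polynomial.eval_X, Polynomial.eval_one]
    have h1 := TM2Iter.eval_mono S.p₂ hn; have h2 := TM2Iter.eval_mono q hn
    omega

end Machine

end MDCompose

end Literature.Computability.Cryptography
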